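import Mathlib
import Summits.NavierStokesRegularity.NavierStokesRegularity.Theorems.EulerZoomLiouvillePowerGaugeEulerLiouvilleGalileanFrameSteadyEuler
import Literature.Analysis.FluidPDE.WeakSolution
import Literature.Analysis.FluidPDE.DistributionalToWeak
import HarnessLib

/-!
# Crux E `PowerGaugeEulerLiouville` (stmt-NavierStokesRegularity-19832), line `galilean-frames` (ns-idea-11 g6/g7), stub F3
# `stub_wanderingReduce` — tools I: TENSOR-TESTED EULER IDENTITIES OF A CLASS MEMBER, SLICE BY SLICE (width seat ns-ezl-w3 g5)

Route №10 `EulerZoomLiouville` (NavierStokesRegularity), crux E.  Member-level bookkeeping used by the wandering-centre stratum (F3) of the line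
`galilean-frames` (and reusable by every «relative equilibrium» stratum): for a distributional Euler pair `(u, p)` on the slab `(−∞,0) × ℝ³`,

* `integral_tensorTest` — for a divergence-free test field `Φ` and `χ ∈ C_c^∞((−∞,0))`:
  `∫ (χ'(τ) ∫⟪u(τ), Φ⟫ + χ(τ) ∫⟪u(τ), DΦ·u(τ)⟫) dτ = 0` (the momentum identity tested with `χ(τ)Φ(y)`, Fubini; the slices of `u` on the support of
  `χ` are assumed to pair integrably with `Φ`, as they do for every explicit ansatz);
* `integral_scalarTensorTest` — `∫ χ(τ) (∫⟪u(τ), ∇φ⟫) dτ = 0` (the divergence identity tested with `χ(τ)φ(y)`);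
* `eq_of_integral_deriv_mul_add_eq_zero_Iio` — by parts + fundamental lemma, LOCAL version: `f` differentiable with derivative `g` on `(−∞,T₁)`,
  `g`, `N` continuous there, `∫(χ' f + χ N) = 0` for all `χ ∈ C_c^∞((−∞,T₁))` ⇒ `N = g` on `(−∞,T₁)`;
* `integral_eq_rpow_mul_integral_comp_affine` — the affine change of variables `y = x₀ + s•Y` (`s > 0`) in `ℝ³`: `∫ h = s³ ∫ h(x₀ + s•Y) dY`.

WHAT THIS IS NOT: not NS regularity, not the crux E — tools for one stratum of the crux CLASS 19832 (MODEL lattice; E/NS strata),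
`--supports` stmt-19832; 19832 OPEN. [folklore; CaffarelliKohnNirenberg1982 §2 (2.1)–(2.2) (distributional form)]
-/

noncomputable section

-- flat `Theorems/<Route><Decl>…` files of one crux share the namespace of the crux (tree convention: `Summit.<S>.<S>.…`)
set_option linter.dupNamespace false

open MeasureTheory Set Filter Topology Metric Function TopologicalSpace InnerProductSpace
open scoped ENNReal NNReal RealInnerProductSpace ContDiff

namespace Summit.NavierStokesRegularity.NavierStokesRegularity.Theorems.PowerGaugeEulerLiouville

namespace GalileanFrames

open Literature.Analysis Literature.Analysis.FunctionSpaces Literature.Analysis.FluidPDE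
open Summit.NavierStokesRegularity.NavierStokesRegularity.Theorems.PowerGaugeEulerLiouville

/-! ### Cut-off products with functions that are only continuous on an open time set -/

/-- If `χ` is continuous with `tsupport χ ⊆ O` (`O` open) and `g` is continuous on `O`, then `χ g` is continuous on `ℝ`. [folklore] -/
theorem continuous_mul_of_tsupport_subset {χ g : ℝ → ℝ} {O : Set ℝ} (hO : IsOpen O) (hχ : Continuous χ)
    (hχO : tsupport χ ⊆ O) (hg : ContinuousOn g O) : Continuous fun t => χ t * g t := by
  refine continuous_iff_continuousAt.2 fun t => ?_
  by_cases ht : t ∈ O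
  · exact hχ.continuousAt.mul (hg.continuousAt (hO.mem_nhds ht))
  · -- near `t` the cut-off vanishes identically
    have hnot : t ∉ tsupport χ := fun h => ht (hχO h)
    have hev : (fun s => χ s * g s) =ᶠ[𝓝 t] fun _ => 0 := by
      have hopen : IsOpen (tsupport χ)ᶜ := (isClosed_tsupport χ).isOpen_compl
      filter_upwards [hopen.mem_nhds hnot] with s hs
      rw [image_eq_zero_of_notMem_tsupport hs, zero_mul]
    exact (continuousAt_const.congr hev.symm)

/-- A product `χ g` as above has compact support. [folklore] -/
theorem hasCompactSupport_mul_right' {χ g : ℝ → ℝ} (hχc : HasCompactSupport χ) : HasCompactSupport fun t => χ t * g t :=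
  hχc.mul_right

/-! ### By parts + fundamental lemma, local version -/

/-- **By parts + fundamental lemma of the calculus of variations on `(−∞, T₁)`.**  If `f` has derivative `g(τ)` at every `τ < T₁`, `g` and
`N` are continuous on `(−∞,T₁)`, and `∫ (χ' f + χ N) = 0` for every smooth `χ` compactly supported in `(−∞, T₁)`, then `N = g` on
`(−∞, T₁)`. [folklore] -/
theorem eq_of_integral_deriv_mul_add_eq_zero_Iio {f g N : ℝ → ℝ} {T₁ : ℝ}
    (hf : ∀ τ, τ < T₁ → HasDerivAt f (g τ) τ) (hg : ContinuousOn g (Iio T₁)) (hN : ContinuousOn N (Iio T₁))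
    (h : ∀ χ : ℝ → ℝ, ContDiff ℝ (⊤ : ℕ∞) χ → HasCompactSupport χ → tsupport χ ⊆ Iio T₁ →
      ∫ τ, (deriv χ τ * f τ + χ τ * N τ) = 0)
    {τ : ℝ} (hτ : τ < T₁) : N τ = g τ := by
  have hfc : ContinuousOn f (Iio T₁) := fun t ht => (hf t ht).continuousAt.continuousWithinAt
  -- by parts: `∫ χ' f = −∫ χ g`
  have hparts : ∀ χ : ℝ → ℝ, ContDiff ℝ (⊤ : ℕ∞) χ → HasCompactSupport χ → tsupport χ ⊆ Iio T₁ →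
      ∫ t, deriv χ t * f t = -∫ t, χ t * g t := by
    intro χ hχ hχc hχT
    have hχd : ∀ x, HasDerivAt χ (deriv χ x) x := fun x => ((hχ.differentiable (by simp)) x).hasDerivAt
    have hχ'c : Continuous (deriv χ) := hχ.continuous_deriv (by simp)
    have hχ's : HasCompactSupport (deriv χ) := hχc.deriv
    have hχ'T : tsupport (deriv χ) ⊆ Iio T₁ := tsupport_deriv_subset.trans hχT
    have i1 : Integrable (χ * g) volume :=
      (continuous_mul_of_tsupport_subset isOpen_Iio hχ.continuous hχT hg).integrable_of_hasCompactSupport hχc.mul_right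
    have i2 : Integrable (deriv χ * f) volume :=
      (continuous_mul_of_tsupport_subset isOpen_Iio hχ'c hχ'T hfc).integrable_of_hasCompactSupport hχ's.mul_right
    obtain ⟨T, -, -, -, hχT'⟩ := exists_bound_Icc_of_hasCompactSupport hχ.continuous hχc
    have hzero : ∀ t, t ∉ Icc (-T) T → (χ * f) t = 0 := fun t ht => by
      have : χ t = 0 := by by_contra hne; exact ht (hχT' t hne)
      simp [this]
    have hbot : Tendsto (χ * f) atBot (𝓝 0) := by
      refine tendsto_const_nhds.congr' ?_
      filter_upwards [eventually_lt_atBot (-T)] with t ht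
      exact (hzero t fun h' => (not_le.2 ht) h'.1).symm
    have htop : Tendsto (χ * f) atTop (𝓝 0) := by
      refine tendsto_const_nhds.congr' ?_
      filter_upwards [eventually_gt_atTop T] with t ht
      exact (hzero t fun h' => (not_le.2 ht) h'.2).symm
    have hip := integral_mul_deriv_eq_deriv_mul (fun x _ => hχd x) (fun x hx => hf x (hχT hx)) i1 i2 hbot htop
    rw [sub_self, zero_sub] at hip
    rw [hip, neg_neg]
  -- hence `∫ χ (N − g) = 0` for every admissible `χ`
  have hzero : ∀ χ : ℝ → ℝ, ContDiff ℝ (⊤ : ℕ∞) χ → HasCompactSupport χ → tsupport χ ⊆ Iio T₁ →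
      ∫ t, χ t • (N t - g t) = 0 := by
    intro χ hχ hχc hχT
    have e := h χ hχ hχc hχT
    have hχ'c : Continuous (deriv χ) := hχ.continuous_deriv (by simp)
    have hχ'T : tsupport (deriv χ) ⊆ Iio T₁ := tsupport_deriv_subset.trans hχT
    have i2 : Integrable (fun t => deriv χ t * f t) volume :=
      (continuous_mul_of_tsupport_subset isOpen_Iio hχ'c hχ'T hfc).integrable_of_hasCompactSupport hχc.deriv.mul_right
    have iN : Integrable (fun t => χ t * N t) volume :=
      (continuous_mul_of_tsupport_subset isOpen_Iio hχ.continuous hχT hN).integrable_of_hasCompactSupport hχc.mul_right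
    have ig : Integrable (fun t => χ t * g t) volume :=
      (continuous_mul_of_tsupport_subset isOpen_Iio hχ.continuous hχT hg).integrable_of_hasCompactSupport hχc.mul_right
    rw [integral_add i2 iN, hparts χ hχ hχc hχT] at e
    have e2 : ∫ t, χ t • (N t - g t) = (∫ t, χ t * N t) - ∫ t, χ t * g t := by
      rw [← integral_sub iN ig]
      refine integral_congr_ae (Eventually.of_forall fun t => ?_)
      simp only [smul_eq_mul]; ring
    rw [e2]; linarith
  have hae := IsOpen.ae_eq_zero_of_integral_contDiff_smul_eq_zero isOpen_Iio
    ((hN.sub hg).locallyIntegrableOn measurableSet_Iio) hzero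
  have hEq : EqOn (fun t => N t - g t) (fun _ => (0 : ℝ)) (Iio T₁) :=
    Measure.eqOn_open_of_ae_eq ((ae_restrict_iff' measurableSet_Iio).2 hae) isOpen_Iio (hN.sub hg) continuousOn_const
  exact sub_eq_zero.1 (hEq hτ)

/-! ### The affine change of variables in `ℝ³` -/

/-- **Affine change of variables** `y = x₀ + s • Y` (`s > 0`) in `ℝ³`, for the Bochner integral of any function: `∫ h = s³ ∫ h(x₀ + s•Y) dY`.
[folklore] -/
theorem integral_eq_rpow_mul_integral_comp_affine {F : Type*} [NormedAddCommGroup F] [NormedSpace ℝ F]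
    (h : EuclideanSpace ℝ (Fin 3) → F) (x₀ : EuclideanSpace ℝ (Fin 3)) {s : ℝ} (hs : 0 < s) :
    ∫ y, h y = s ^ 3 • ∫ Y, h (x₀ + s • Y) := by
  have h1 : ∫ Y, h (x₀ + s • Y) = ∫ Y, (fun z => h (x₀ + z)) (s • Y) := rfl
  rw [h1, Measure.integral_comp_smul volume (fun z => h (x₀ + z)) s, finrank_euclideanSpace_fin,
    integral_add_left_eq_self (fun z => h z) x₀, smul_smul]
  rw [abs_of_pos (inv_pos.2 (pow_pos hs 3)), mul_inv_cancel₀ (pow_pos hs 3).ne', one_smul]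

/-! ### Tensor-tested Euler identities of a class member -/

section Member

variable {u : ℝ → EuclideanSpace ℝ (Fin 3) → EuclideanSpace ℝ (Fin 3)} {p : ℝ → EuclideanSpace ℝ (Fin 3) → ℝ}

/-- **THE MOMENTUM IDENTITY OF A DISTRIBUTIONAL EULER PAIR, TESTED WITH A TENSOR FIELD** `χ(τ)Φ(y)` (`Φ` a divergence-free test field,
`χ ∈ C_c^∞((−∞,0))`; the slices `u(τ)` on `tsupport χ` are assumed to pair integrably with `Φ` and `DΦ·u(τ)`):
`∫ (χ'(τ) ∫⟪u(τ), Φ⟫ + χ(τ) ∫⟪u(τ), DΦ·u(τ)⟫) dτ = 0`. [cite: CaffarelliKohnNirenberg1982, §2 (2.1)–(2.2)] -/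
theorem integral_tensorTest
    (hsol : IsDistributionalNSSolutionOn (slab (EuclideanSpace ℝ (Fin 3)) (Iio 0) isOpen_Iio) 0 0 u p)
    {Φ : EuclideanSpace ℝ (Fin 3) → EuclideanSpace ℝ (Fin 3)} (hΦ : IsTestFunctionOn (⊤ : Opens (EuclideanSpace ℝ (Fin 3))) Φ)
    (hdiv : ∀ z, VectorCalculus.divergence Φ z = 0)
    {χ : ℝ → ℝ} (hχ : ContDiff ℝ (⊤ : ℕ∞) χ) (hχc : HasCompactSupport χ) (hχ0 : tsupport χ ⊆ Iio 0)
    (hint₁ : ∀ τ ∈ tsupport χ, Integrable (fun y => ⟪u τ y, Φ y⟫) volume)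
    (hint₂ : ∀ τ ∈ tsupport χ, Integrable (fun y => ⟪u τ y, (fderiv ℝ Φ y) (u τ y)⟫) volume) :
    ∫ τ, (deriv χ τ * (∫ y, ⟪u τ y, Φ y⟫) + χ τ * ∫ y, ⟪u τ y, (fderiv ℝ Φ y) (u τ y)⟫) = 0 := by
  have hΦc : Continuous Φ := hΦ.contDiff.continuous
  have hΦd : Differentiable ℝ Φ := hΦ.contDiff.differentiable (by simp)
  have hDΦc : Continuous (fderiv ℝ Φ) := hΦ.contDiff.continuous_fderiv (by simp)
  have hDΦs : HasCompactSupport (fderiv ℝ Φ) := hΦ.hasCompactSupport.fderiv (𝕜 := ℝ)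
  have hχd : Differentiable ℝ χ := hχ.differentiable (by simp)
  have hχ'c : Continuous (deriv χ) := hχ.continuous_deriv (by simp)
  have hχ0' : ∀ t, t ∉ tsupport χ → χ t = 0 := fun t ht => image_eq_zero_of_notMem_tsupport ht
  have hχ'0' : ∀ t, t ∉ tsupport χ → deriv χ t = 0 := fun t ht => by
    by_contra hne; exact ht (tsupport_deriv_subset (subset_tsupport _ (mem_support.2 hne)))
  -- the tensor test field and the momentum identity
  have hΨ : IsSpaceTimeTestOn (slab (EuclideanSpace ℝ (Fin 3)) (Iio 0) isOpen_Iio)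
      (fun s (x : EuclideanSpace ℝ (Fin 3)) => χ s • Φ x) :=
    isSpaceTimeTestOn_slab_smul isOpen_Iio hχ hχc hχ0 hΦ
  have id0 := hsol.2.2.2.2 _ hΨ
  -- the integrand, simplified
  set G : ℝ × EuclideanSpace ℝ (Fin 3) → ℝ := fun z =>
    deriv χ z.1 * ⟪u z.1 z.2, Φ z.2⟫ + χ z.1 * ⟪u z.1 z.2, (fderiv ℝ Φ z.2) (u z.1 z.2)⟫ with hG
  have hslab : ((slab (EuclideanSpace ℝ (Fin 3)) (Iio 0) isOpen_Iio : Opens (ℝ × EuclideanSpace ℝ (Fin 3))) :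
      Set (ℝ × EuclideanSpace ℝ (Fin 3))) = Iio (0 : ℝ) ×ˢ (univ : Set (EuclideanSpace ℝ (Fin 3))) :=
    coe_slab (X := EuclideanSpace ℝ (Fin 3)) (Iio 0) isOpen_Iio
  have hGint : ∫ z in Iio (0 : ℝ) ×ˢ (univ : Set (EuclideanSpace ℝ (Fin 3))), G z = 0 := by
    rw [← hslab]
    refine Eq.trans (setIntegral_congr_fun
      (slab (EuclideanSpace ℝ (Fin 3)) (Iio 0) isOpen_Iio).isOpen.measurableSet fun z _ => ?_) id0
    have hTD : timeDeriv (fun s (x : EuclideanSpace ℝ (Fin 3)) => χ s • Φ x) z.1 z.2 = deriv χ z.1 • Φ z.2 := by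
      rw [timeDeriv_apply]; exact deriv_smul_const (hχd z.1) (Φ z.2)
    have hCV : convect (u z.1) (fun x : EuclideanSpace ℝ (Fin 3) => χ z.1 • Φ x) z.2 =
        χ z.1 • (fderiv ℝ Φ z.2) (u z.1 z.2) := by
      rw [convect_apply, fderiv_fun_const_smul (hΦd z.2) (χ z.1)]
      rfl
    have hDV : VectorCalculus.divergence (fun x : EuclideanSpace ℝ (Fin 3) => χ z.1 • Φ x) z.2 = 0 := by
      rw [divergence_const_smul hΦd, hdiv, mul_zero]
    rw [hTD, hCV, hDV]
    simp only [hG, zero_mul, add_zero, mul_zero, Pi.zero_apply, inner_zero_left, inner_smul_right]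
  -- integrability of `G` on the slab: local integrability of `u`, `|u|²` (class) + compact support
  set K : Set (ℝ × EuclideanSpace ℝ (Fin 3)) := tsupport χ ×ˢ tsupport Φ with hK
  have hKc : IsCompact K := hχc.prod hΦ.hasCompactSupport
  have hKS : K ⊆ Iio (0 : ℝ) ×ˢ (univ : Set (EuclideanSpace ℝ (Fin 3))) := prod_mono hχ0 (subset_univ _)
  obtain ⟨Cχ, hCχ⟩ := hχ.continuous.bounded_above_of_compact_support hχc
  obtain ⟨Cχ', hCχ'⟩ := hχ'c.bounded_above_of_compact_support hχc.deriv
  obtain ⟨CΦ, hCΦ⟩ := hΦc.bounded_above_of_compact_support hΦ.hasCompactSupport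
  obtain ⟨CΦ', hCΦ'⟩ := hDΦc.bounded_above_of_compact_support hDΦs
  have hCχ0 : 0 ≤ Cχ := (norm_nonneg _).trans (hCχ 0)
  have hCχ'0 : 0 ≤ Cχ' := (norm_nonneg _).trans (hCχ' 0)
  have hCΦ0 : 0 ≤ CΦ := (norm_nonneg _).trans (hCΦ 0)
  have hCΦ'0 : 0 ≤ CΦ' := (norm_nonneg _).trans (hCΦ' 0)
  have hu1 : LocallyIntegrableOn (uncurry u) (Iio (0 : ℝ) ×ˢ (univ : Set (EuclideanSpace ℝ (Fin 3)))) volume := by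
    have h := hsol.1; rwa [hslab] at h
  have hu2 : LocallyIntegrableOn (fun z => ‖uncurry u z‖ ^ 2) (Iio (0 : ℝ) ×ˢ (univ : Set (EuclideanSpace ℝ (Fin 3)))) volume := by
    have h := hsol.2.1; rwa [hslab] at h
  set bound : ℝ × EuclideanSpace ℝ (Fin 3) → ℝ := K.indicator fun z =>
    Cχ' * CΦ * ‖uncurry u z‖ + Cχ * CΦ' * ‖uncurry u z‖ ^ 2 with hbound
  have hbi : Integrable bound volume := by
    rw [hbound, integrable_indicator_iff hKc.measurableSet]
    exact (((hu1.integrableOn_compact_subset hKS hKc).norm.const_mul _).add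
      ((hu2.integrableOn_compact_subset hKS hKc).const_mul _))
  have hum : AEStronglyMeasurable (uncurry u) (volume.restrict (Iio (0 : ℝ) ×ˢ (univ : Set (EuclideanSpace ℝ (Fin 3))))) :=
    hu1.aestronglyMeasurable
  have hGm : AEStronglyMeasurable G (volume.restrict (Iio (0 : ℝ) ×ˢ (univ : Set (EuclideanSpace ℝ (Fin 3))))) := by
    have h1 : AEStronglyMeasurable (fun z : ℝ × EuclideanSpace ℝ (Fin 3) => (fderiv ℝ Φ z.2) (uncurry u z))
        (volume.restrict (Iio (0 : ℝ) ×ˢ (univ : Set (EuclideanSpace ℝ (Fin 3))))) :=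
      (isBoundedBilinearMap_apply (𝕜 := ℝ) (E := EuclideanSpace ℝ (Fin 3)) (F := EuclideanSpace ℝ (Fin 3))).continuous
        |>.comp_aestronglyMeasurable ((hDΦc.comp continuous_snd).aestronglyMeasurable.prodMk hum)
    exact (((hχ'c.comp continuous_fst).aestronglyMeasurable).mul (hum.inner (hΦc.comp continuous_snd).aestronglyMeasurable)).add
      (((hχ.continuous.comp continuous_fst).aestronglyMeasurable).mul (hum.inner h1))
  have hGi : IntegrableOn G (Iio (0 : ℝ) ×ˢ (univ : Set (EuclideanSpace ℝ (Fin 3)))) volume := by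
    refine hbi.integrableOn.mono' hGm (Eventually.of_forall fun z => ?_)
    by_cases hz : z ∈ K
    · rw [hbound, indicator_of_mem hz, hG]
      refine (norm_add_le _ _).trans (add_le_add ?_ ?_)
      · rw [norm_mul]
        calc ‖deriv χ z.1‖ * ‖⟪u z.1 z.2, Φ z.2⟫‖ ≤ Cχ' * (‖u z.1 z.2‖ * CΦ) :=
              mul_le_mul (hCχ' _) ((norm_inner_le_norm _ _).trans (mul_le_mul_of_nonneg_left (hCΦ _) (norm_nonneg _)))
                (norm_nonneg _) hCχ'0
          _ = Cχ' * CΦ * ‖uncurry u z‖ := by simp only [uncurry]; ring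
      · rw [norm_mul]
        calc ‖χ z.1‖ * ‖⟪u z.1 z.2, (fderiv ℝ Φ z.2) (u z.1 z.2)⟫‖ ≤ Cχ * (‖u z.1 z.2‖ * (CΦ' * ‖u z.1 z.2‖)) := by
              refine mul_le_mul (hCχ _) ((norm_inner_le_norm _ _).trans (mul_le_mul_of_nonneg_left ?_ (norm_nonneg _)))
                (norm_nonneg _) hCχ0
              exact (ContinuousLinearMap.le_opNorm _ _).trans (mul_le_mul_of_nonneg_right (hCΦ' _) (norm_nonneg _))
          _ = Cχ * CΦ' * ‖uncurry u z‖ ^ 2 := by simp only [uncurry]; ring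
    · -- off `K` the integrand vanishes
      have hG0 : G z = 0 := by
        rcases not_and_or.1 (fun h' => hz (mem_prod.2 h')) with h1 | h2
        · simp only [hG, hχ0' z.1 h1, hχ'0' z.1 h1, zero_mul, add_zero]
        · have hΦ0 : Φ z.2 = 0 := image_eq_zero_of_notMem_tsupport h2
          have hDΦ0 : fderiv ℝ Φ z.2 = 0 := by
            by_contra hne; exact h2 (support_fderiv_subset ℝ (mem_support.2 hne))
          simp only [hG, hΦ0, hDΦ0, inner_zero_right, mul_zero, add_zero, zero_apply]
      rw [hG0, norm_zero, hbound]
      exact indicator_nonneg (fun w _ => add_nonneg (mul_nonneg (mul_nonneg hCχ'0 hCΦ0) (norm_nonneg _))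
        (mul_nonneg (mul_nonneg hCχ0 hCΦ'0) (sq_nonneg _))) _
  -- Fubini
  have hprod : (volume.restrict (Iio (0 : ℝ) ×ˢ (univ : Set (EuclideanSpace ℝ (Fin 3)))) : Measure (ℝ × EuclideanSpace ℝ (Fin 3))) =
      ((volume : Measure ℝ).restrict (Iio 0)).prod (volume : Measure (EuclideanSpace ℝ (Fin 3))) := by
    rw [Measure.volume_eq_prod, ← Measure.prod_restrict, Measure.restrict_univ]
  have hF : ∫ z in Iio (0 : ℝ) ×ˢ (univ : Set (EuclideanSpace ℝ (Fin 3))), G z = ∫ τ in Iio (0 : ℝ), ∫ y, G (τ, y) := by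
    rw [hprod, integral_prod _ (by rw [← hprod]; exact hGi)]
  rw [hF] at hGint
  -- from `(−∞,0)` to `ℝ`, and the inner integrals
  have hinner : ∀ τ : ℝ, ∫ y, G (τ, y) = deriv χ τ * (∫ y, ⟪u τ y, Φ y⟫) + χ τ * ∫ y, ⟪u τ y, (fderiv ℝ Φ y) (u τ y)⟫ := by
    intro τ
    by_cases hτ : τ ∈ tsupport χ
    · simp only [hG]
      rw [integral_add ((hint₁ τ hτ).const_mul _) ((hint₂ τ hτ).const_mul _), integral_const_mul, integral_const_mul]
    · simp only [hG, hχ0' τ hτ, hχ'0' τ hτ, zero_mul, add_zero, integral_zero]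
  have hout : ∫ τ in Iio (0 : ℝ), ∫ y, G (τ, y) = ∫ τ, ∫ y, G (τ, y) := by
    refine setIntegral_eq_integral_of_forall_compl_eq_zero fun τ hτ => ?_
    have hτ' : τ ∉ tsupport χ := fun h' => hτ (hχ0 h')
    rw [hinner τ, hχ0' τ hτ', hχ'0' τ hτ', zero_mul, zero_mul, add_zero]
  rw [hout] at hGint
  simp_rw [hinner] at hGint
  exact hGint

/-- **THE DIVERGENCE IDENTITY OF A DISTRIBUTIONAL EULER PAIR, TESTED WITH A TENSOR** `χ(τ)φ(y)`: `∫ χ(τ) (∫⟪u(τ), ∇φ⟫) dτ = 0` (no slice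
hypothesis: a non-integrable slice pairing has Bochner integral `0`, and those slices form a null set). [cite: CaffarelliKohnNirenberg1982, §2 (2.1)] -/
theorem integral_scalarTensorTest
    (hsol : IsDistributionalNSSolutionOn (slab (EuclideanSpace ℝ (Fin 3)) (Iio 0) isOpen_Iio) 0 0 u p)
    {φ : EuclideanSpace ℝ (Fin 3) → ℝ} (hφ : IsTestFunctionOn (⊤ : Opens (EuclideanSpace ℝ (Fin 3))) φ)
    {χ : ℝ → ℝ} (hχ : ContDiff ℝ (⊤ : ℕ∞) χ) (hχc : HasCompactSupport χ) (hχ0 : tsupport χ ⊆ Iio 0) :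
    ∫ τ, χ τ * ∫ y, ⟪u τ y, gradient φ y⟫ = 0 := by
  have hG := isTestFunctionOn_gradient_field hφ
  have hφd : Differentiable ℝ φ := hφ.contDiff.differentiable (by simp)
  have hgc : Continuous (gradient φ) := hG.contDiff.continuous
  have hχ0' : ∀ t, t ∉ tsupport χ → χ t = 0 := fun t ht => image_eq_zero_of_notMem_tsupport ht
  have hΘ : IsSpaceTimeTestOn (slab (EuclideanSpace ℝ (Fin 3)) (Iio 0) isOpen_Iio)
      (fun s (x : EuclideanSpace ℝ (Fin 3)) => χ s • φ x) :=
    isSpaceTimeTestOn_slab_smul isOpen_Iio hχ hχc hχ0 hφ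
  have id0 := hsol.2.2.2.1 _ hΘ
  set G : ℝ × EuclideanSpace ℝ (Fin 3) → ℝ := fun z => χ z.1 * ⟪u z.1 z.2, gradient φ z.2⟫ with hGdef
  have hslab : ((slab (EuclideanSpace ℝ (Fin 3)) (Iio 0) isOpen_Iio : Opens (ℝ × EuclideanSpace ℝ (Fin 3))) :
      Set (ℝ × EuclideanSpace ℝ (Fin 3))) = Iio (0 : ℝ) ×ˢ (univ : Set (EuclideanSpace ℝ (Fin 3))) :=
    coe_slab (X := EuclideanSpace ℝ (Fin 3)) (Iio 0) isOpen_Iio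
  have hGint : ∫ z in Iio (0 : ℝ) ×ˢ (univ : Set (EuclideanSpace ℝ (Fin 3))), G z = 0 := by
    rw [← hslab]
    refine Eq.trans (setIntegral_congr_fun
      (slab (EuclideanSpace ℝ (Fin 3)) (Iio 0) isOpen_Iio).isOpen.measurableSet fun z _ => ?_) id0
    have hgr : gradient ((fun s (x : EuclideanSpace ℝ (Fin 3)) => χ s • φ x) z.1) z.2 = χ z.1 • gradient φ z.2 :=
      gradient_const_mul hφd (χ z.1) z.2
    rw [hgr, inner_smul_right]
  -- integrability on the slab
  set K : Set (ℝ × EuclideanSpace ℝ (Fin 3)) := tsupport χ ×ˢ tsupport (gradient φ) with hK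
  have hKc : IsCompact K := hχc.prod hG.hasCompactSupport
  have hKS : K ⊆ Iio (0 : ℝ) ×ˢ (univ : Set (EuclideanSpace ℝ (Fin 3))) := prod_mono hχ0 (subset_univ _)
  obtain ⟨Cχ, hCχ⟩ := hχ.continuous.bounded_above_of_compact_support hχc
  obtain ⟨Cg, hCg⟩ := hgc.bounded_above_of_compact_support hG.hasCompactSupport
  have hCχ0 : 0 ≤ Cχ := (norm_nonneg _).trans (hCχ 0)
  have hCg0 : 0 ≤ Cg := (norm_nonneg _).trans (hCg 0)
  have hu1 : LocallyIntegrableOn (uncurry u) (Iio (0 : ℝ) ×ˢ (univ : Set (EuclideanSpace ℝ (Fin 3)))) volume := by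
    have h := hsol.1; rwa [hslab] at h
  set bound : ℝ × EuclideanSpace ℝ (Fin 3) → ℝ := K.indicator fun z => Cχ * Cg * ‖uncurry u z‖ with hbound
  have hbi : Integrable bound volume := by
    rw [hbound, integrable_indicator_iff hKc.measurableSet]
    exact ((hu1.integrableOn_compact_subset hKS hKc).norm.const_mul _)
  have hum : AEStronglyMeasurable (uncurry u) (volume.restrict (Iio (0 : ℝ) ×ˢ (univ : Set (EuclideanSpace ℝ (Fin 3))))) :=
    hu1.aestronglyMeasurable
  have hGm : AEStronglyMeasurable G (volume.restrict (Iio (0 : ℝ) ×ˢ (univ : Set (EuclideanSpace ℝ (Fin 3))))) :=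
    ((hχ.continuous.comp continuous_fst).aestronglyMeasurable).mul (hum.inner (hgc.comp continuous_snd).aestronglyMeasurable)
  have hGi : IntegrableOn G (Iio (0 : ℝ) ×ˢ (univ : Set (EuclideanSpace ℝ (Fin 3)))) volume := by
    refine hbi.integrableOn.mono' hGm (Eventually.of_forall fun z => ?_)
    by_cases hz : z ∈ K
    · rw [hbound, indicator_of_mem hz, hGdef, norm_mul]
      calc ‖χ z.1‖ * ‖⟪u z.1 z.2, gradient φ z.2⟫‖ ≤ Cχ * (‖u z.1 z.2‖ * Cg) :=
            mul_le_mul (hCχ _) ((norm_inner_le_norm _ _).trans (mul_le_mul_of_nonneg_left (hCg _) (norm_nonneg _)))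
              (norm_nonneg _) hCχ0
        _ = Cχ * Cg * ‖uncurry u z‖ := by simp only [uncurry]; ring
    · have hG0 : G z = 0 := by
        rcases not_and_or.1 (fun h' => hz (mem_prod.2 h')) with h1 | h2
        · simp only [hGdef, hχ0' z.1 h1, zero_mul]
        · have h0 : gradient φ z.2 = 0 := image_eq_zero_of_notMem_tsupport h2
          simp only [hGdef, h0, inner_zero_right, mul_zero]
      rw [hG0, norm_zero, hbound]
      exact indicator_nonneg (fun w _ => mul_nonneg (mul_nonneg hCχ0 hCg0) (norm_nonneg _)) _
  have hprod : (volume.restrict (Iio (0 : ℝ) ×ˢ (univ : Set (EuclideanSpace ℝ (Fin 3)))) : Measure (ℝ × EuclideanSpace ℝ (Fin 3))) =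
      ((volume : Measure ℝ).restrict (Iio 0)).prod (volume : Measure (EuclideanSpace ℝ (Fin 3))) := by
    rw [Measure.volume_eq_prod, ← Measure.prod_restrict, Measure.restrict_univ]
  have hF : ∫ z in Iio (0 : ℝ) ×ˢ (univ : Set (EuclideanSpace ℝ (Fin 3))), G z = ∫ τ in Iio (0 : ℝ), ∫ y, G (τ, y) := by
    rw [hprod, integral_prod _ (by rw [← hprod]; exact hGi)]
  rw [hF] at hGint
  have hinner : ∀ τ : ℝ, ∫ y, G (τ, y) = χ τ * ∫ y, ⟪u τ y, gradient φ y⟫ := by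
    intro τ
    simp only [hGdef]
    rw [integral_const_mul]
  have hout : ∫ τ in Iio (0 : ℝ), ∫ y, G (τ, y) = ∫ τ, ∫ y, G (τ, y) := by
    refine setIntegral_eq_integral_of_forall_compl_eq_zero fun τ hτ => ?_
    have hτ' : τ ∉ tsupport χ := fun h' => hτ (hχ0 h')
    rw [hinner τ, hχ0' τ hτ', zero_mul]
  rw [hout] at hGint
  simp_rw [hinner] at hGint
  exact hGint

end Member

end GalileanFrames

end Summit.NavierStokesRegularity.NavierStokesRegularity.Theorems.PowerGaugeEulerLiouville
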